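import Literature.NumberTheory.Rogawski1990.ArchCentralLimitCompactWallReduction     -- ★ p843372∕p843405 (A4)-R: brings ★ CornerTransfer (wall01 form, dictionary), ★ Leibniz, ★ Value (`quarter_sub_eq_of_wallGerms`), ★ ChamberReduction∕AngleChart
import Literature.NumberTheory.Rogawski1990.ArchCentralLimitCompactWallOrbital       -- ★ p843448 (A4)-I: `orbital_comp_swap01_eq`, `contDiffOn_orbital_angleChart_off_noncompact_walls`, wall-point facts
import Literature.NumberTheory.Rogawski1990.ArchCentralLimitWallToCorner             -- ★ p843602: `tendsto_comp_wallCurve_of_tendsto_nhdsWithin_chamber` (the diagonal argument), brings ★ RayJetsOneSided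
import HarnessLib

/-!
# THE VALUE OF THE WALL LIMIT: if `Λ₈[F_Θ]` has a limit at the centre of `U(2,1)` along the regular set, that limit is read off the compact wall — no corner extension
# (Rogawski 1990 §8.4 p. 126 L13 «`ω[ρ(γ)′Δ(γ)Φ_G(γ,f)]` is continuous at `γ₀` …»; Harish-Chandra 1975 [H₂] L. 17.5 — FILE A of «A6′», the continuity half of that sentence as N1's print input)

Topic `NumberTheory/Rogawski1990`; namespace `Literature.NumberTheory.Rogawski1990`.  THEOREMS ONLY (no `def`, no instance, no notation, no axiom, no named fact, no `sorry`).
Cell `pub/hodgecm-mathlib`, ENGINE T1 (crux H413 = `stmt-HodgeConjecture-24833`), supports-only lane; pay-down mirror «SdArch» `Cruxes/H413/Lines/F0_P3a_SdArch.lean` ED. 5 (one open stub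
`stub_A6 : ∀ L α w, ArchCentralLimitCornerRegularity L α w`, PRINTED [HC 1975 §17 L. 17.5], books #179).  Author F0P3a-p09 (g2), 2026-09-01 (offer «A6′ — the literal half-sentence row», P3a bus
18:35Z; LEAD F0P3a-plan (g12) T11-1: candidate re-denomination of #179, count-neutral).  FILE B = `ArchCentralLimitFormulaOfLimitExists` (the frame transport and the letter).

THE POINT.  ROAD A's ED. 4 derivation of the N1 letter ★ `ArchCentralLimitFormulaRankTwo` consumed the print row (A6) = `C³` CORNER EXTENSIONS of `F_Θ∘chart` on each of the six chambers
(★ `ArchCentralLimitCornerRegularity`), which is STRONGER than what Rogawski quotes from [H₂] L. 17.5 («`ω[ρ′ΔΦ_G]` is CONTINUOUS AT `γ₀`» = the limit along the regular set EXISTS).  This file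
shows the wall machinery needs only that existence:
* §1 (generic, base point `x`): the 8-ray LINE functional `Λ^∠[f](x) = (1∕48) Σ_ε ε₀ε₁ε₂ (d∕ds)³|₀ f(x + s·v_ε)` of a function `C³` on an open `W ∋ x` is `¼(D³f(x)(A⃗,A⃗,N⃗) − D³f(x)(N⃗,N⃗,N⃗))`
  (★ `sum_sign_cube_signedRay_eq_of_symmetric`), at a wall base point `x = tA⃗` it is `¼((d∕dτ)²|₀(d∕ds)|₀ f(tA⃗+τA⃗+sN⃗) − (d∕ds)³|₀ f(tA⃗+sN⃗))` (★ `iteratedDeriv_two_deriv_comp_plane_eq`,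
  ★ `iteratedDeriv_three_line_eq_iteratedFDeriv`), and `x ↦ Λ^∠[f](x)` is CONTINUOUS on `W` (★ `continuousAt_iteratedDeriv_comp_line`);
* §2 **the wall twin of ★ (A4)-R** `eq_wallGermValue_of_tendsto_lambda8Line_wall`: for `Φ` even under the compact reflection and `C³` off the noncompact walls, with `|1−w|²`-normalised
  germs `ψ = m·Φ(k_·)`, `χ = m²·N²Φ(k_·)` of class `C²` on `[0, δ]`: IF `Λ^∠[(ρ′Δ·Φ)∘chart](tA⃗) → V` as `t → 0⁺` THEN `V = −(2∕3)i·ψ″(0⁺) − (1∕2)i·ψ(0) + (1∕12)i·χ″(0⁺)` (and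
  `12ψ(0) = 6χ(0)`, `12ψ′(0⁺) = 6χ′(0⁺)`): the mixed wall jet `(d∕dτ)²NF(k_t) = (−2iψ)″(t)` converges UNCONDITIONALLY (★ `tendsto_iteratedDeriv_two_nhdsGT`), so the normal cube
  `N³F(k_t) = (d∕dτ)²NF(k_t) − 4Λ^∠(tA⃗)` converges too, and ★ `quarter_sub_eq_of_wallGerms` applies WITHOUT a corner extension (★ (A4)-R took both limits from the extension `H`);
* §3 the DIAGONAL STEP: a limit of `Λ^∠[f]` from inside a `θ₂`-minimal chamber + continuity of `Λ^∠[f]` on an open set containing the wall points ⇒ the limit along `tA⃗`, `t → 0⁺`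
  (★ `tendsto_comp_wallCurve_of_tendsto_nhdsWithin_chamber`, Warner's «the manner in which the point is approached is immaterial»; the chart reduction of the letter's filter is in FILE B);
* §4 both at the ORBITAL INTEGRAL of `G_w` (compact pair `{0,1}`): evenness ★ `orbital_comp_swap01_eq`, `C^∞` off the noncompact walls ★ (A1) `contDiffOn_orbital_angleChart_off_noncompact_walls`,
  wall points off the noncompact walls ★ `wallPoint_off_noncompact_walls`.
HONEST LABEL: HC_CM is proved only modulo the printed citations until rung 0 closes; wall bookkeeping over ★ files, pays no row by itself.

## References
* [Rogawski1990] J. D. Rogawski, *Automorphic Representations of Unitary Groups in Three Variables*, Ann. of Math. Stud. 123 (1990), §8.4 pp. 126–127 (held scan p0126–p0127 read).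
* [Varadarajan1989] V. S. Varadarajan, *An Introduction to Harmonic Analysis on Semisimple Lie Groups* (1989), §6.4.
* [WarnerHASSLG2] G. Warner, *Harmonic Analysis on Semi-Simple Lie Groups II* (1972), §8.5.1 («the manner in which the point is approached is immaterial»).
* [Dieudonne1960] J. Dieudonné, *Foundations of Modern Analysis* (1960), Ch. VIII §12 (symmetry and continuity of higher derivatives).
-/

set_option autoImplicit false

noncomputable section

open Filter Topology Set Function Complex MeasureTheory Measure NumberField NumberField.InfinitePlace Matrix MulAction
open scoped ContDiff Matrix MatrixGroups Matrix.Norms.Operator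
open Literature.Analysis.Calculus Literature.Topology
open Literature.NumberTheory.Automorphic Literature.NumberTheory.Automorphic.UnitaryGroup
open Literature.Geometry.ComplexHyperbolic Literature.Geometry.ComplexHyperbolic.BallModel

namespace Literature.NumberTheory.Rogawski1990

/-! ## §1 Generic: the 8-ray line functional `Λ^∠[f](x)` of a `C³` function at a base point — wall-adapted form, continuity -/


section LineFunctional

variable {f : (Fin 3 → ℝ) → ℂ} {W : Set (Fin 3 → ℝ)}

/-- **`Λ^∠[f](x) = ¼(D³f(x)(A⃗,A⃗,N⃗) − D³f(x)(N⃗,N⃗,N⃗))`** at any base point `x` of an open set `W` on which `f` is `C³` (`A⃗ = (1,1,−2)`, `N⃗ = (1,−1,0)`): the ray jets at `x` are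
`D³f(x)(v,v,v)` (★ `iteratedDeriv_comp_line_zero_of_le`), `D³f(x)` is symmetric (★ `iteratedFDeriv_comp_perm_of_le`), and ★ `sum_sign_cube_signedRay_eq_of_symmetric` is the wall
polarisation of the cubic `∏_{i<j}(ξ_i − ξ_j)`. [cite: Rogawski1990, §8.4 p. 126] [cite: Dieudonne1960, Ch. VIII §12 (8.12.4)] -/
theorem lambda8Line_eq_quarter_wall01_form (hW : IsOpen W) (hf : ContDiffOn ℝ 3 f W) {x : Fin 3 → ℝ} (hx : x ∈ W) :
    (1 / 48 : ℂ) * ∑ ε : Fin 3 → Bool, ((((if ε 0 then (1 : ℝ) else -1) * (if ε 1 then (1 : ℝ) else -1) * (if ε 2 then (1 : ℝ) else -1) : ℝ)) : ℂ) *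
        iteratedDeriv 3 (fun s : ℝ => f (x + s • (![(if ε 0 then (1 : ℝ) else -1) + (if ε 1 then (1 : ℝ) else -1), -(if ε 0 then (1 : ℝ) else -1) + (if ε 2 then (1 : ℝ) else -1),
          -(if ε 1 then (1 : ℝ) else -1) - (if ε 2 then (1 : ℝ) else -1)] : Fin 3 → ℝ))) 0 =
      (1 / 4 : ℂ) * (iteratedFDeriv ℝ 3 f x ![![1, 1, -2], ![1, 1, -2], ![1, -1, 0]] - iteratedFDeriv ℝ 3 f x ![![1, -1, 0], ![1, -1, 0], ![1, -1, 0]]) := by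
  have hray : ∀ v : Fin 3 → ℝ, iteratedDeriv 3 (fun s : ℝ => f (x + s • v)) 0 = iteratedFDeriv ℝ 3 f x (fun _ => v) := fun v =>
    iteratedDeriv_comp_line_zero_of_le hW hf hx v (k := 3) le_rfl
  simp only [hray]
  have hsym : ∀ (v : Fin 3 → (Fin 3 → ℝ)) (σ : Equiv.Perm (Fin 3)), iteratedFDeriv ℝ 3 f x (v ∘ σ) = iteratedFDeriv ℝ 3 f x v := fun v σ =>
    iteratedFDeriv_comp_perm_of_le (𝕜 := ℝ) (hf.contDiffAt (hW.mem_nhds hx)) le_rfl v σ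
  rw [sum_sign_cube_signedRay_eq_of_symmetric _ hsym]
  ring

/-- **`Λ^∠[f](tA⃗) = ¼((d∕dτ)²|₀(d∕ds)|₀ f(tA⃗ + τA⃗ + sN⃗) − (d∕ds)³|₀ f(tA⃗ + sN⃗))`** at a wall base point `tA⃗ ∈ W`: the wall-JET form (★ `iteratedDeriv_two_deriv_comp_plane_eq` for the mixed
reading, ★ `iteratedDeriv_three_line_eq_iteratedFDeriv` for the normal cube). [cite: Rogawski1990, §8.4 p. 126] [cite: Dieudonne1960, Ch. VIII §12 (8.12.4)] -/
theorem lambda8Line_wallPoint_eq_quarter_wall01_jets (hW : IsOpen W) (hf : ContDiffOn ℝ 3 f W) {t : ℝ} (ht : t • (![1, 1, -2] : Fin 3 → ℝ) ∈ W) :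
    (1 / 48 : ℂ) * ∑ ε : Fin 3 → Bool, ((((if ε 0 then (1 : ℝ) else -1) * (if ε 1 then (1 : ℝ) else -1) * (if ε 2 then (1 : ℝ) else -1) : ℝ)) : ℂ) *
        iteratedDeriv 3 (fun s : ℝ => f (t • (![1, 1, -2] : Fin 3 → ℝ) + s • (![(if ε 0 then (1 : ℝ) else -1) + (if ε 1 then (1 : ℝ) else -1), -(if ε 0 then (1 : ℝ) else -1) + (if ε 2 then (1 : ℝ) else -1),
          -(if ε 1 then (1 : ℝ) else -1) - (if ε 2 then (1 : ℝ) else -1)] : Fin 3 → ℝ))) 0 =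
      (1 / 4 : ℂ) * (iteratedDeriv 2 (fun τ : ℝ => deriv (fun s : ℝ =>
          f (t • (![1, 1, -2] : Fin 3 → ℝ) + τ • (![1, 1, -2] : Fin 3 → ℝ) + s • (![1, -1, 0] : Fin 3 → ℝ))) 0) 0
        - iteratedDeriv 3 (fun s : ℝ => f (t • (![1, 1, -2] : Fin 3 → ℝ) + s • (![1, -1, 0] : Fin 3 → ℝ))) 0) := by
  rw [lambda8Line_eq_quarter_wall01_form hW hf ht, iteratedDeriv_two_deriv_comp_plane_eq hW hf le_rfl ht (![1, 1, -2] : Fin 3 → ℝ) (![1, -1, 0] : Fin 3 → ℝ),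
    iteratedDeriv_three_line_eq_iteratedFDeriv f hW hf ht (![1, -1, 0] : Fin 3 → ℝ)]

/-- **`x ↦ Λ^∠[f](x)` is continuous on `W`** (each ray jet `x ↦ (d∕ds)³|₀ f(x + s·v)` is, ★ `continuousAt_iteratedDeriv_comp_line`). [cite: Dieudonne1960, Ch. VIII §12 (8.12.1)] -/
theorem continuousOn_lambda8Line (hW : IsOpen W) (hf : ContDiffOn ℝ 3 f W) :
    ContinuousOn (fun x : Fin 3 → ℝ => (1 / 48 : ℂ) * ∑ ε : Fin 3 → Bool, ((((if ε 0 then (1 : ℝ) else -1) * (if ε 1 then (1 : ℝ) else -1) * (if ε 2 then (1 : ℝ) else -1) : ℝ)) : ℂ) *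
        iteratedDeriv 3 (fun s : ℝ => f (x + s • (![(if ε 0 then (1 : ℝ) else -1) + (if ε 1 then (1 : ℝ) else -1), -(if ε 0 then (1 : ℝ) else -1) + (if ε 2 then (1 : ℝ) else -1),
          -(if ε 1 then (1 : ℝ) else -1) - (if ε 2 then (1 : ℝ) else -1)] : Fin 3 → ℝ))) 0) W := by
  intro x hx
  refine ContinuousAt.continuousWithinAt ?_
  refine continuousAt_const.mul (tendsto_finsetSum _ fun ε _ => continuousAt_const.mul ?_)
  exact continuousAt_iteratedDeriv_comp_line hW hf hx _ (k := 3) le_rfl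

end LineFunctional

/-! ## §2 The wall twin of ★ (A4)-R: IF `Λ^∠[(ρ′Δ·Φ)∘chart](tA⃗)` has a limit as `t → 0⁺`, that limit is the wall-germ value — no corner extension -/

section WallTwin

/-- **THE COMPACT-WALL VALUE FROM THE EXISTENCE OF THE WALL LIMIT (side `t > 0`).**  Let `Φ : (S¹)³ → ℂ` be invariant under the compact Weyl reflection `(0 1)`, with `Φ∘chart_ζ` of class
`C³` on an open `W` containing the wall points `tA⃗`, `t ∈ (0, δ)` (`A⃗ = (1,1,−2)`); let `F := (ρ′Δ·Φ)∘chart_ζ` (the letter's `F_Θ` in the chart) and let `ψ = m·Φ(k_·)`, `χ = m²·N²Φ(k_·)`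
(`k_t = ζe^{itA⃗}`, `m = 2 − 2cos 3t`, `N⃗ = (1,−1,0)`) be of class `C²` on `[0, δ]`.  IF the 8-ray line functional `Λ^∠[F](tA⃗) = (1∕48) Σ_ε ε₀ε₁ε₂ (d∕ds)³|₀ F(tA⃗ + s·v_ε)` tends to `V` as
`t → 0⁺`, THEN `V = −(2∕3)i·ψ″(0⁺) − (1∕2)i·ψ(0) + (1∕12)i·χ″(0⁺)`, `12ψ(0) = 6χ(0)` and `12ψ′(0⁺) = 6χ′(0⁺)`.  Proof: at `tA⃗`, `Λ^∠[F] = ¼((d∕dτ)²NF − N³F)` (§1); by ★ Leibniz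
`(d∕dτ)²NF(k_t) = (−2iψ)″(t)` — convergent as `t → 0⁺` since `ψ ∈ C²[0,δ]` (★ `tendsto_iteratedDeriv_two_nhdsGT`) — and `N³F(k_t) = 2iψ + (12iψ − 6iχ)∕m`; so `N³F(k_t) =
(d∕dτ)²NF(k_t) − 4Λ^∠[F](tA⃗)` converges TOO, and ★ `quarter_sub_eq_of_wallGerms` applies.  (★ (A4)-R `lambda8Angle_cornerExtension_eq_of_compactWallGerms` obtained the two limits from a
`C³` corner extension `H`; here the existence of `lim Λ^∠[F](tA⃗)` replaces `H`.) [cite: Rogawski1990, §8.4 pp. 126–127] [cite: Varadarajan1989, §6.4] -/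
theorem eq_wallGermValue_of_tendsto_lambda8Line_wall (Φ : (Fin 3 → Circle) → ℂ)
    (hΦsymm : ∀ z : Fin 3 → Circle, Φ (z ∘ (Equiv.swap (0 : Fin 3) 1)) = Φ z) (ζ : Circle)
    {W : Set (Fin 3 → ℝ)} (hW : IsOpen W) (hΦW : ContDiffOn ℝ 3 (fun θ : Fin 3 → ℝ => Φ (fun j => ζ * Circle.exp (θ j))) W)
    {δ : ℝ} (hδ : 0 < δ) (hwall : ∀ t ∈ Ioo 0 δ, t • (![1, 1, -2] : Fin 3 → ℝ) ∈ W)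
    {ψ χ : ℝ → ℂ} (hψ : ContDiffOn ℝ 2 ψ (Icc 0 δ)) (hχ : ContDiffOn ℝ 2 χ (Icc 0 δ))
    (hψdef : ∀ t ∈ Ioo 0 δ, ψ t = ((2 - 2 * Real.cos (3 * t) : ℝ) : ℂ) * Φ (fun j => ζ * Circle.exp ((t • (![1, 1, -2] : Fin 3 → ℝ)) j)))
    (hχdef : ∀ t ∈ Ioo 0 δ, χ t = ((2 - 2 * Real.cos (3 * t) : ℝ) : ℂ) ^ 2 *
      iteratedDeriv 2 (fun s : ℝ => Φ (fun j => (fun i : Fin 3 => ζ * Circle.exp ((t • (![1, 1, -2] : Fin 3 → ℝ)) i)) j *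
        Circle.exp (s * (![1, -1, 0] : Fin 3 → ℝ) j))) 0)
    {V : ℂ} (hV : Tendsto (fun t : ℝ => (1 / 48 : ℂ) * ∑ ε : Fin 3 → Bool, ((((if ε 0 then (1 : ℝ) else -1) * (if ε 1 then (1 : ℝ) else -1) * (if ε 2 then (1 : ℝ) else -1) : ℝ)) : ℂ) *
        iteratedDeriv 3 (fun s : ℝ => (fun θ : Fin 3 → ℝ =>
          (((ζ * Circle.exp (θ 0) : Circle) : ℂ)) * ((((ζ * Circle.exp (θ 2) : Circle) : ℂ)))⁻¹ *
            ((1 - (((ζ * Circle.exp (θ 1) : Circle) : ℂ)) * ((((ζ * Circle.exp (θ 0) : Circle) : ℂ)))⁻¹) *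
              (1 - (((ζ * Circle.exp (θ 2) : Circle) : ℂ)) * ((((ζ * Circle.exp (θ 1) : Circle) : ℂ)))⁻¹) *
              (1 - (((ζ * Circle.exp (θ 2) : Circle) : ℂ)) * ((((ζ * Circle.exp (θ 0) : Circle) : ℂ)))⁻¹)) *
            Φ (fun j => ζ * Circle.exp (θ j)))
          (t • (![1, 1, -2] : Fin 3 → ℝ) + s • (![(if ε 0 then (1 : ℝ) else -1) + (if ε 1 then (1 : ℝ) else -1), -(if ε 0 then (1 : ℝ) else -1) + (if ε 2 then (1 : ℝ) else -1),
            -(if ε 1 then (1 : ℝ) else -1) - (if ε 2 then (1 : ℝ) else -1)] : Fin 3 → ℝ))) 0) (𝓝[>] 0) (𝓝 V)) :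
    V = -(2 / 3) * I * iteratedDerivWithin 2 ψ (Icc 0 δ) 0 - (1 / 2) * I * ψ 0 + (1 / 12) * I * iteratedDerivWithin 2 χ (Icc 0 δ) 0 ∧
      12 * ψ 0 = 6 * χ 0 ∧ 12 * derivWithin ψ (Icc 0 δ) 0 = 6 * derivWithin χ (Icc 0 δ) 0 := by
  -- the honest function `F = (ρ′Δ·Φ)∘chart_ζ` is `C³` on `W`
  set F : (Fin 3 → ℝ) → ℂ := fun θ : Fin 3 → ℝ =>
      (((ζ * Circle.exp (θ 0) : Circle) : ℂ)) * ((((ζ * Circle.exp (θ 2) : Circle) : ℂ)))⁻¹ *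
        ((1 - (((ζ * Circle.exp (θ 1) : Circle) : ℂ)) * ((((ζ * Circle.exp (θ 0) : Circle) : ℂ)))⁻¹) *
          (1 - (((ζ * Circle.exp (θ 2) : Circle) : ℂ)) * ((((ζ * Circle.exp (θ 1) : Circle) : ℂ)))⁻¹) *
          (1 - (((ζ * Circle.exp (θ 2) : Circle) : ℂ)) * ((((ζ * Circle.exp (θ 0) : Circle) : ℂ)))⁻¹)) *
        Φ (fun j => ζ * Circle.exp (θ j)) with hFdef
  have hF : ContDiffOn ℝ 3 F W :=
    ((contDiff_rhoWeylDelta_angleChart ζ).of_le (by exact_mod_cast ENat.natCast_le_of_coe_top_le_withTop le_rfl 3)).contDiffOn.mul hΦW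
  have hIoo : ∀ᶠ t : ℝ in 𝓝[>] 0, t ∈ Ioo 0 δ := Ioo_mem_nhdsGT hδ
  -- the wall point `k_t` and the dictionary (as in ★ (A4)-R)
  have hk01 : ∀ t : ℝ, (fun j : Fin 3 => ζ * Circle.exp ((t • (![1, 1, -2] : Fin 3 → ℝ)) j)) 0 = (fun j : Fin 3 => ζ * Circle.exp ((t • (![1, 1, -2] : Fin 3 → ℝ)) j)) 1 :=
    fun t => angleChart_wall01_apply_zero_eq_one ζ t
  have hray : ∀ t : ℝ, (fun s : ℝ => F (t • (![1, 1, -2] : Fin 3 → ℝ) + s • (![1, -1, 0] : Fin 3 → ℝ))) = fun s : ℝ =>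
      (fun z' : Fin 3 → Circle => ((z' 0 : ℂ) * ((z' 2 : ℂ))⁻¹ *
          ((1 - (z' 1 : ℂ) * ((z' 0 : ℂ))⁻¹) * (1 - (z' 2 : ℂ) * ((z' 1 : ℂ))⁻¹) * (1 - (z' 2 : ℂ) * ((z' 0 : ℂ))⁻¹))) * Φ z')
        (fun j => (fun i : Fin 3 => ζ * Circle.exp ((t • (![1, 1, -2] : Fin 3 → ℝ)) i)) j * Circle.exp (s * (![1, -1, 0] : Fin 3 → ℝ) j)) := by
    intro t
    funext s
    have h := angleChart_wall01_add_normal ζ t s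
    have h0 := congrFun h 0
    have h1 := congrFun h 1
    have h2 := congrFun h 2
    simp only [hFdef]
    rw [h, h0, h1, h2]
  -- smoothness of `Φ` along the normal ray at `k_t`, `t ∈ (0, δ)`
  have hP : ∀ t ∈ Ioo 0 δ, ContDiffAt ℝ 3 (fun s : ℝ => Φ (fun j => (fun i : Fin 3 => ζ * Circle.exp ((t • (![1, 1, -2] : Fin 3 → ℝ)) i)) j * Circle.exp (s * (![1, -1, 0] : Fin 3 → ℝ) j))) 0 := by
    intro t ht
    have hmem : t • (![1, 1, -2] : Fin 3 → ℝ) + (0 : ℝ) • (![1, -1, 0] : Fin 3 → ℝ) ∈ W := by simpa only [zero_smul, add_zero] using hwall t ht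
    have hline : ContDiff ℝ 3 (fun s : ℝ => t • (![1, 1, -2] : Fin 3 → ℝ) + s • (![1, -1, 0] : Fin 3 → ℝ)) :=
      contDiff_const.add (contDiff_id.smul contDiff_const)
    have hcomp : ContDiffAt ℝ 3 ((fun θ : Fin 3 → ℝ => Φ (fun j => ζ * Circle.exp (θ j))) ∘ (fun s : ℝ => t • (![1, 1, -2] : Fin 3 → ℝ) + s • (![1, -1, 0] : Fin 3 → ℝ))) 0 :=
      (hΦW.contDiffAt (hW.mem_nhds hmem)).comp 0 hline.contDiffAt
    refine hcomp.congr_of_eventuallyEq (Eventually.of_forall fun s => ?_)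
    simp only [Function.comp_apply, angleChart_wall01_add_normal ζ t s]
  -- the ★ Leibniz coefficients at `k_t` as functions of `t`
  have hcoef : ∀ t : ℝ,
      2 * I * ((((fun j : Fin 3 => ζ * Circle.exp ((t • (![1, 1, -2] : Fin 3 → ℝ)) j)) 0 : Circle) : ℂ) * ((((fun j : Fin 3 => ζ * Circle.exp ((t • (![1, 1, -2] : Fin 3 → ℝ)) j)) 2 : Circle) : ℂ))⁻¹) *
          (1 - (((fun j : Fin 3 => ζ * Circle.exp ((t • (![1, 1, -2] : Fin 3 → ℝ)) j)) 2 : Circle) : ℂ) * ((((fun j : Fin 3 => ζ * Circle.exp ((t • (![1, 1, -2] : Fin 3 → ℝ)) j)) 0 : Circle) : ℂ))⁻¹) ^ 2 =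
        -2 * I * ((2 - 2 * Real.cos (3 * t) : ℝ) : ℂ) ∧
      2 * I * ((((fun j : Fin 3 => ζ * Circle.exp ((t • (![1, 1, -2] : Fin 3 → ℝ)) j)) 0 : Circle) : ℂ) * ((((fun j : Fin 3 => ζ * Circle.exp ((t • (![1, 1, -2] : Fin 3 → ℝ)) j)) 2 : Circle) : ℂ))⁻¹) *
          (8 * ((((fun j : Fin 3 => ζ * Circle.exp ((t • (![1, 1, -2] : Fin 3 → ℝ)) j)) 2 : Circle) : ℂ) * ((((fun j : Fin 3 => ζ * Circle.exp ((t • (![1, 1, -2] : Fin 3 → ℝ)) j)) 0 : Circle) : ℂ))⁻¹) - 1 -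
            ((((fun j : Fin 3 => ζ * Circle.exp ((t • (![1, 1, -2] : Fin 3 → ℝ)) j)) 2 : Circle) : ℂ) * ((((fun j : Fin 3 => ζ * Circle.exp ((t • (![1, 1, -2] : Fin 3 → ℝ)) j)) 0 : Circle) : ℂ))⁻¹) ^ 2) =
        12 * I + 2 * I * ((2 - 2 * Real.cos (3 * t) : ℝ) : ℂ) := by
    intro t
    obtain ⟨h02, h20⟩ := wallPoint_ratio ζ t
    rw [h02, h20, firstJetCoeff_eq_wallNormaliser, thirdJetCoeff_eq_wallNormaliser]
    exact ⟨rfl, rfl⟩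
  -- (i) the normal cube `N³F(k_t)` in germ form, eventually along `𝓝[>] 0`
  have hcube : ∀ᶠ t : ℝ in 𝓝[>] 0, iteratedDeriv 3 (fun s : ℝ => F (t • (![1, 1, -2] : Fin 3 → ℝ) + s • (![1, -1, 0] : Fin 3 → ℝ))) 0 =
      2 * I * ψ t + (12 * I * ψ t - 6 * I * χ t) / ((2 - 2 * Real.cos (3 * t) : ℝ) : ℂ) := by
    filter_upwards [hIoo, eventually_nhdsGT_wallNormaliser_ne_zero] with t ht hm
    have hm' : (((2 - 2 * Real.cos (3 * t) : ℝ)) : ℂ) ≠ 0 := by exact_mod_cast hm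
    rw [hray t, iteratedDeriv_three_rhoWeylDelta_mul_normalRay_zero Φ hΦsymm _ (hk01 t) (hP t ht), (hcoef t).1, (hcoef t).2,
      hψdef t ht, hχdef t ht]
    generalize (((2 - 2 * Real.cos (3 * t) : ℝ)) : ℂ) = M at hm' ⊢
    generalize Φ (fun j : Fin 3 => ζ * Circle.exp ((t • (![1, 1, -2] : Fin 3 → ℝ)) j)) = Φk
    generalize iteratedDeriv 2 (fun s : ℝ => Φ (fun j => (fun i : Fin 3 => ζ * Circle.exp ((t • (![1, 1, -2] : Fin 3 → ℝ)) i)) j *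
        Circle.exp (s * (![1, -1, 0] : Fin 3 → ℝ) j))) 0 = P
    field_simp
    ring
  -- (ii) the first normal derivative `NF(k_τ) = −2i·ψ(τ)` for `τ ∈ (0, δ)`, hence the mixed jet is `(−2iψ)″(t)`
  have hfirst : ∀ τ ∈ Ioo 0 δ, deriv (fun s : ℝ => F (τ • (![1, 1, -2] : Fin 3 → ℝ) + s • (![1, -1, 0] : Fin 3 → ℝ))) 0 = -2 * I * ψ τ := by
    intro τ hτ
    rw [hray τ, deriv_rhoWeylDelta_mul_normalRay_zero Φ _ (hk01 τ) ((hP τ hτ).of_le (by norm_num)), (hcoef τ).1, hψdef τ hτ]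
    ring
  have hmixed : ∀ᶠ t : ℝ in 𝓝[>] 0, iteratedDeriv 2 (fun τ : ℝ => deriv (fun s : ℝ => F (t • (![1, 1, -2] : Fin 3 → ℝ) + τ • (![1, 1, -2] : Fin 3 → ℝ) + s • (![1, -1, 0] : Fin 3 → ℝ))) 0) 0 =
      iteratedDeriv 2 (fun τ : ℝ => -2 * I * ψ τ) t := by
    filter_upwards [hIoo] with t ht
    have hev : (fun τ : ℝ => deriv (fun s : ℝ => F (t • (![1, 1, -2] : Fin 3 → ℝ) + τ • (![1, 1, -2] : Fin 3 → ℝ) + s • (![1, -1, 0] : Fin 3 → ℝ))) 0) =ᶠ[𝓝 0] fun τ : ℝ => (fun τ' : ℝ => -2 * I * ψ τ') (t + τ) := by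
      have hmem : ∀ᶠ τ : ℝ in 𝓝 0, t + τ ∈ Ioo 0 δ := by
        have hc : Continuous fun τ : ℝ => t + τ := by fun_prop
        exact hc.continuousAt.eventually_mem (by simpa only [add_zero] using isOpen_Ioo.mem_nhds ht)
      filter_upwards [hmem] with τ hτ
      rw [← hfirst (t + τ) hτ, add_smul]
    rw [hev.iteratedDeriv_eq 2, iteratedDeriv_comp_const_add 2 (fun τ' : ℝ => -2 * I * ψ τ') t]
    simp only [add_zero]
  -- the mixed-jet limit exists UNCONDITIONALLY (`ψ ∈ C²[0, δ]`)
  have hL₁ : Tendsto (fun t : ℝ => iteratedDeriv 2 (fun τ : ℝ => -2 * I * ψ τ) t) (𝓝[>] 0)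
      (𝓝 (iteratedDerivWithin 2 (fun τ : ℝ => -2 * I * ψ τ) (Icc 0 δ) 0)) := tendsto_iteratedDeriv_two_nhdsGT hδ (contDiffOn_const.mul hψ)
  -- the functional at the wall points in jet form, eventually
  have hΛ : ∀ᶠ t : ℝ in 𝓝[>] 0, (1 / 48 : ℂ) * ∑ ε : Fin 3 → Bool, ((((if ε 0 then (1 : ℝ) else -1) * (if ε 1 then (1 : ℝ) else -1) * (if ε 2 then (1 : ℝ) else -1) : ℝ)) : ℂ) *
        iteratedDeriv 3 (fun s : ℝ => F (t • (![1, 1, -2] : Fin 3 → ℝ) + s • (![(if ε 0 then (1 : ℝ) else -1) + (if ε 1 then (1 : ℝ) else -1), -(if ε 0 then (1 : ℝ) else -1) + (if ε 2 then (1 : ℝ) else -1),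
          -(if ε 1 then (1 : ℝ) else -1) - (if ε 2 then (1 : ℝ) else -1)] : Fin 3 → ℝ))) 0 =
      (1 / 4 : ℂ) * (iteratedDeriv 2 (fun τ : ℝ => -2 * I * ψ τ) t - (2 * I * ψ t + (12 * I * ψ t - 6 * I * χ t) / ((2 - 2 * Real.cos (3 * t) : ℝ) : ℂ))) := by
    filter_upwards [hIoo, hcube, hmixed] with t ht hc hm
    rw [lambda8Line_wallPoint_eq_quarter_wall01_jets hW hF (hwall t ht), hm, hc]
  -- hence the normal-cube limit exists too: `N³F(k_t) = (d∕dτ)²NF(k_t) − 4Λ^∠(tA⃗)`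
  have hL₂ : Tendsto (fun t : ℝ => 2 * I * ψ t + (12 * I * ψ t - 6 * I * χ t) / ((2 - 2 * Real.cos (3 * t) : ℝ) : ℂ)) (𝓝[>] 0)
      (𝓝 (iteratedDerivWithin 2 (fun τ : ℝ => -2 * I * ψ τ) (Icc 0 δ) 0 - 4 * V)) := by
    refine (hL₁.sub (hV.const_mul 4)).congr' ?_
    filter_upwards [hΛ] with t ht
    rw [ht]
    ring
  obtain ⟨hval, hrel0, hrel1⟩ := quarter_sub_eq_of_wallGerms hδ hψ hχ hL₁ hL₂
  refine ⟨?_, hrel0, hrel1⟩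
  rw [← hval]
  ring

end WallTwin

/-! ## §3 The diagonal step: a limit from inside a `θ₂`-minimal chamber is the limit along the compact wall -/

section Diagonal

/-- `σ 0 = 2` forces `(σ 1, σ 2) ∈ {(0,1), (1,0)}`. [folklore] -/
private theorem perm_fin_three_of_apply_zero_eq_two' (σ : Equiv.Perm (Fin 3)) (h : σ 0 = 2) : (σ 1 = 0 ∧ σ 2 = 1) ∨ (σ 1 = 1 ∧ σ 2 = 0) := by
  revert σ
  decide

/-- **THE DIAGONAL STEP (wall limit from the chamber limit).**  Let `f` be `C³` on an open `W` containing the wall points `tA⃗`, `t ∈ (0, δ)`, and suppose the 8-ray line functional `Λ^∠[f]`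
tends to `V` at the corner from inside a `θ₂`-MINIMAL chamber `C_σ` (`σ 0 = 2`).  Then `Λ^∠[f](tA⃗) → V` as `t → 0⁺`: the wall curve is weakly `σ`-ordered (`−2t ≤ t ≤ t`), stays in `W`,
and `Λ^∠[f]` is continuous on `W` (§1) — ★ `tendsto_comp_wallCurve_of_tendsto_nhdsWithin_chamber` («the manner in which the point is approached is immaterial»).
[cite: WarnerHASSLG2, §8.5.1 proof of Thm. 8.5.1.6] [cite: Rogawski1990, §8.4 pp. 126–127] -/
theorem tendsto_lambda8Line_wall_of_tendsto_nhdsWithin_chamber {f : (Fin 3 → ℝ) → ℂ} {W : Set (Fin 3 → ℝ)} (hW : IsOpen W) (hf : ContDiffOn ℝ 3 f W)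
    {δ : ℝ} (hδ : 0 < δ) (hwall : ∀ t ∈ Ioo 0 δ, t • (![1, 1, -2] : Fin 3 → ℝ) ∈ W) (σ : Equiv.Perm (Fin 3)) (hσ : σ 0 = 2) {V : ℂ}
    (hV : Tendsto (fun x : Fin 3 → ℝ => (1 / 48 : ℂ) * ∑ ε : Fin 3 → Bool, ((((if ε 0 then (1 : ℝ) else -1) * (if ε 1 then (1 : ℝ) else -1) * (if ε 2 then (1 : ℝ) else -1) : ℝ)) : ℂ) *
        iteratedDeriv 3 (fun s : ℝ => f (x + s • (![(if ε 0 then (1 : ℝ) else -1) + (if ε 1 then (1 : ℝ) else -1), -(if ε 0 then (1 : ℝ) else -1) + (if ε 2 then (1 : ℝ) else -1),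
          -(if ε 1 then (1 : ℝ) else -1) - (if ε 2 then (1 : ℝ) else -1)] : Fin 3 → ℝ))) 0)
      (𝓝[{θ : Fin 3 → ℝ | θ (σ 0) < θ (σ 1) ∧ θ (σ 1) < θ (σ 2)}] 0) (𝓝 V)) :
    Tendsto (fun t : ℝ => (1 / 48 : ℂ) * ∑ ε : Fin 3 → Bool, ((((if ε 0 then (1 : ℝ) else -1) * (if ε 1 then (1 : ℝ) else -1) * (if ε 2 then (1 : ℝ) else -1) : ℝ)) : ℂ) *
        iteratedDeriv 3 (fun s : ℝ => f (t • (![1, 1, -2] : Fin 3 → ℝ) + s • (![(if ε 0 then (1 : ℝ) else -1) + (if ε 1 then (1 : ℝ) else -1), -(if ε 0 then (1 : ℝ) else -1) + (if ε 2 then (1 : ℝ) else -1),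
          -(if ε 1 then (1 : ℝ) else -1) - (if ε 2 then (1 : ℝ) else -1)] : Fin 3 → ℝ))) 0) (𝓝[>] 0) (𝓝 V) := by
  have hγ : Tendsto (fun t : ℝ => t • (![1, 1, -2] : Fin 3 → ℝ)) (𝓝[>] 0) (𝓝 0) := by
    have hc : Continuous fun t : ℝ => t • (![1, 1, -2] : Fin 3 → ℝ) := continuous_id.smul continuous_const
    simpa only [zero_smul] using (hc.tendsto 0).mono_left nhdsWithin_le_nhds
  have hγle : ∀ᶠ t : ℝ in 𝓝[>] 0, (t • (![1, 1, -2] : Fin 3 → ℝ)) (σ 0) ≤ (t • (![1, 1, -2] : Fin 3 → ℝ)) (σ 1) ∧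
      (t • (![1, 1, -2] : Fin 3 → ℝ)) (σ 1) ≤ (t • (![1, 1, -2] : Fin 3 → ℝ)) (σ 2) := by
    filter_upwards [self_mem_nhdsWithin] with t ht
    have ht' : (0 : ℝ) < t := ht
    rcases perm_fin_three_of_apply_zero_eq_two' σ hσ with ⟨h1, h2⟩ | ⟨h1, h2⟩ <;>
      · simp only [hσ, h1, h2, Pi.smul_apply, smul_eq_mul, Matrix.cons_val_zero, Matrix.cons_val_one, Matrix.cons_val_two, Matrix.tail_cons, Matrix.head_cons]
        constructor <;> nlinarith
  have hγW : ∀ᶠ t : ℝ in 𝓝[>] 0, t • (![1, 1, -2] : Fin 3 → ℝ) ∈ W := by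
    filter_upwards [Ioo_mem_nhdsGT hδ] with t ht using hwall t ht
  exact tendsto_comp_wallCurve_of_tendsto_nhdsWithin_chamber σ hV hW (continuousOn_lambda8Line hW hf) hγ hγle hγW

end Diagonal

/-! ## §4 At the orbital integral of `G_w` (compact pair `{0,1}`): evenness and smoothness off the noncompact walls are ★ (A1)∕Weyl; the wall points are off the noncompact walls -/

section Orbital

variable (L : Type) [Field L] (α : Fin 3 → L) (w : {w : InfinitePlace L // IsComplex w})
  [MeasurableSpace (archLocal L 3 (Matrix.diagonal α) w)] [BorelSpace (archLocal L 3 (Matrix.diagonal α) w)]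

/-- **WALL LIMIT ⟹ WALL-GERM VALUE, at the orbital integral** (side `t > 0`).  Data: the compact pair `0 < re σ_wα₀·re σ_wα₁`; `ν` right-invariant, finite on compacta; `Θ` smooth with
compact support on `G_w`; `Φ` THE ORBITAL INTEGRAL (`hΦ`); `0 < δ ≤ 2`; germs `ψ = m·Φ(k_·)`, `χ = m²·N²Φ(k_·)` of class `C²` on `[0, δ]`.  IF the 8-ray line functional of
`F_Θ∘chart_ζ = (ρ′Δ·Φ)∘chart_ζ` at the wall points `tA⃗` tends to `V` as `t → 0⁺`, THEN `V = −(2∕3)i·ψ″(0⁺) − (1∕2)i·ψ(0) + (1∕12)i·χ″(0⁺)`, `12ψ(0) = 6χ(0)`, `12ψ′(0⁺) = 6χ′(0⁺)`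
(§2 with (i) ★ `orbital_comp_swap01_eq`, (ii) ★ `contDiffOn_orbital_angleChart_off_noncompact_walls`, and ★ `wallPoint_off_noncompact_walls`). [cite: Rogawski1990, §8.4 pp. 126–127] [cite: Varadarajan1989, §6.4] -/
theorem eq_wallGermValue_of_tendsto_lambda8Line_wall_orbital (hα : ∀ i, α i ≠ 0) (hreal : ∀ i, (w.1.embedding (α i)).im = 0)
    (hcpt : 0 < (w.1.embedding (α 0)).re * (w.1.embedding (α 1)).re)
    (ν : Measure (archLocal L 3 (Matrix.diagonal α) w)) [IsFiniteMeasureOnCompacts ν] [ν.IsMulRightInvariant]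
    (Θ : Matrix (Fin 3) (Fin 3) ℂ → ℂ) (hΘ : ContDiff ℝ ∞ Θ)
    (hΘc : HasCompactSupport fun k : archLocal L 3 (Matrix.diagonal α) w => Θ ((k : GL (Fin 3) ℂ) : Matrix (Fin 3) (Fin 3) ℂ))
    (ζ : Circle) (Φ : (Fin 3 → Circle) → ℂ)
    (hΦ : Φ = fun z => ∫ g, Θ (((g * ⟨circleDiagonal 3 z, circleDiagonal_mem_archLocal_diagonal L 3 α w z⟩ * g⁻¹ :
        archLocal L 3 (Matrix.diagonal α) w) : GL (Fin 3) ℂ) : Matrix (Fin 3) (Fin 3) ℂ) ∂ν)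
    {δ : ℝ} (hδ : 0 < δ) (hδ2 : δ ≤ 2)
    {ψ χ : ℝ → ℂ} (hψ : ContDiffOn ℝ 2 ψ (Icc 0 δ)) (hχ : ContDiffOn ℝ 2 χ (Icc 0 δ))
    (hψdef : ∀ t ∈ Ioo 0 δ, ψ t = ((2 - 2 * Real.cos (3 * t) : ℝ) : ℂ) * Φ (fun j => ζ * Circle.exp ((t • (![1, 1, -2] : Fin 3 → ℝ)) j)))
    (hχdef : ∀ t ∈ Ioo 0 δ, χ t = ((2 - 2 * Real.cos (3 * t) : ℝ) : ℂ) ^ 2 *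
      iteratedDeriv 2 (fun s : ℝ => Φ (fun j => (fun i : Fin 3 => ζ * Circle.exp ((t • (![1, 1, -2] : Fin 3 → ℝ)) i)) j *
        Circle.exp (s * (![1, -1, 0] : Fin 3 → ℝ) j))) 0)
    {V : ℂ} (hV : Tendsto (fun t : ℝ => (1 / 48 : ℂ) * ∑ ε : Fin 3 → Bool, ((((if ε 0 then (1 : ℝ) else -1) * (if ε 1 then (1 : ℝ) else -1) * (if ε 2 then (1 : ℝ) else -1) : ℝ)) : ℂ) *
        iteratedDeriv 3 (fun s : ℝ => (fun θ : Fin 3 → ℝ =>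
          (((ζ * Circle.exp (θ 0) : Circle) : ℂ)) * ((((ζ * Circle.exp (θ 2) : Circle) : ℂ)))⁻¹ *
            ((1 - (((ζ * Circle.exp (θ 1) : Circle) : ℂ)) * ((((ζ * Circle.exp (θ 0) : Circle) : ℂ)))⁻¹) *
              (1 - (((ζ * Circle.exp (θ 2) : Circle) : ℂ)) * ((((ζ * Circle.exp (θ 1) : Circle) : ℂ)))⁻¹) *
              (1 - (((ζ * Circle.exp (θ 2) : Circle) : ℂ)) * ((((ζ * Circle.exp (θ 0) : Circle) : ℂ)))⁻¹)) *
            Φ (fun j => ζ * Circle.exp (θ j)))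
          (t • (![1, 1, -2] : Fin 3 → ℝ) + s • (![(if ε 0 then (1 : ℝ) else -1) + (if ε 1 then (1 : ℝ) else -1), -(if ε 0 then (1 : ℝ) else -1) + (if ε 2 then (1 : ℝ) else -1),
            -(if ε 1 then (1 : ℝ) else -1) - (if ε 2 then (1 : ℝ) else -1)] : Fin 3 → ℝ))) 0) (𝓝[>] 0) (𝓝 V)) :
    V = -(2 / 3) * I * iteratedDerivWithin 2 ψ (Icc 0 δ) 0 - (1 / 2) * I * ψ 0 + (1 / 12) * I * iteratedDerivWithin 2 χ (Icc 0 δ) 0 ∧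
      12 * ψ 0 = 6 * χ 0 ∧ 12 * derivWithin ψ (Icc 0 δ) 0 = 6 * derivWithin χ (Icc 0 δ) 0 := by
  -- (i) Weyl evenness and (ii) smoothness off the noncompact walls, for the orbital integral
  have hΦsymm : ∀ z : Fin 3 → Circle, Φ (z ∘ (Equiv.swap (0 : Fin 3) 1)) = Φ z := by
    intro z
    rw [hΦ]
    exact orbital_comp_swap01_eq L α w hα hreal hcpt ν Θ z
  set W : Set (Fin 3 → ℝ) := {θ : Fin 3 → ℝ | ζ * Circle.exp (θ 0) ≠ ζ * Circle.exp (θ 2) ∧ ζ * Circle.exp (θ 1) ≠ ζ * Circle.exp (θ 2)} with hWdef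
  have hW : IsOpen W := isOpen_setOf_off_noncompact_walls ζ
  have hΦW : ContDiffOn ℝ 3 (fun θ : Fin 3 → ℝ => Φ (fun j => ζ * Circle.exp (θ j))) W := by
    rw [hΦ]
    exact (contDiffOn_orbital_angleChart_off_noncompact_walls L α w hα hreal hcpt ν Θ hΘ hΘc ζ).of_le
      (by exact_mod_cast ENat.natCast_le_of_coe_top_le_withTop le_rfl 3)
  have hwall : ∀ t ∈ Ioo 0 δ, t • (![1, 1, -2] : Fin 3 → ℝ) ∈ W := fun t ht =>
    wallPoint_off_noncompact_walls ζ (ne_of_gt ht.1) (by rw [abs_of_pos ht.1]; linarith [ht.2])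
  exact eq_wallGermValue_of_tendsto_lambda8Line_wall Φ hΦsymm ζ hW hΦW hδ hwall hψ hχ hψdef hχdef hV

/-- **CHAMBER LIMIT ⟹ WALL LIMIT, at the orbital integral**: if the 8-ray line functional of `F_Θ∘chart_ζ` tends to `V` at the corner from inside a `θ₂`-minimal chamber (`σ 0 = 2`), then it
tends to `V` along the wall points `tA⃗`, `t → 0⁺` (§3 on the open set off the noncompact walls, where `F_Θ∘chart_ζ` is `C³` by ★ (A1)). [cite: Rogawski1990, §8.4 pp. 126–127] [cite: WarnerHASSLG2, §8.5.1] -/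
theorem tendsto_lambda8Line_wall_orbital (hα : ∀ i, α i ≠ 0) (hreal : ∀ i, (w.1.embedding (α i)).im = 0)
    (hcpt : 0 < (w.1.embedding (α 0)).re * (w.1.embedding (α 1)).re)
    (ν : Measure (archLocal L 3 (Matrix.diagonal α) w)) [IsFiniteMeasureOnCompacts ν]
    (Θ : Matrix (Fin 3) (Fin 3) ℂ → ℂ) (hΘ : ContDiff ℝ ∞ Θ)
    (hΘc : HasCompactSupport fun k : archLocal L 3 (Matrix.diagonal α) w => Θ ((k : GL (Fin 3) ℂ) : Matrix (Fin 3) (Fin 3) ℂ))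
    (ζ : Circle) (Φ : (Fin 3 → Circle) → ℂ)
    (hΦ : Φ = fun z => ∫ g, Θ (((g * ⟨circleDiagonal 3 z, circleDiagonal_mem_archLocal_diagonal L 3 α w z⟩ * g⁻¹ :
        archLocal L 3 (Matrix.diagonal α) w) : GL (Fin 3) ℂ) : Matrix (Fin 3) (Fin 3) ℂ) ∂ν)
    (σ : Equiv.Perm (Fin 3)) (hσ : σ 0 = 2) {V : ℂ}
    (hV : Tendsto (fun x : Fin 3 → ℝ => (1 / 48 : ℂ) * ∑ ε : Fin 3 → Bool, ((((if ε 0 then (1 : ℝ) else -1) * (if ε 1 then (1 : ℝ) else -1) * (if ε 2 then (1 : ℝ) else -1) : ℝ)) : ℂ) *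
        iteratedDeriv 3 (fun s : ℝ => (fun θ : Fin 3 → ℝ =>
          (((ζ * Circle.exp (θ 0) : Circle) : ℂ)) * ((((ζ * Circle.exp (θ 2) : Circle) : ℂ)))⁻¹ *
            ((1 - (((ζ * Circle.exp (θ 1) : Circle) : ℂ)) * ((((ζ * Circle.exp (θ 0) : Circle) : ℂ)))⁻¹) *
              (1 - (((ζ * Circle.exp (θ 2) : Circle) : ℂ)) * ((((ζ * Circle.exp (θ 1) : Circle) : ℂ)))⁻¹) *
              (1 - (((ζ * Circle.exp (θ 2) : Circle) : ℂ)) * ((((ζ * Circle.exp (θ 0) : Circle) : ℂ)))⁻¹)) *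
            Φ (fun j => ζ * Circle.exp (θ j)))
          (x + s • (![(if ε 0 then (1 : ℝ) else -1) + (if ε 1 then (1 : ℝ) else -1), -(if ε 0 then (1 : ℝ) else -1) + (if ε 2 then (1 : ℝ) else -1),
            -(if ε 1 then (1 : ℝ) else -1) - (if ε 2 then (1 : ℝ) else -1)] : Fin 3 → ℝ))) 0)
      (𝓝[{θ : Fin 3 → ℝ | θ (σ 0) < θ (σ 1) ∧ θ (σ 1) < θ (σ 2)}] 0) (𝓝 V)) :
    Tendsto (fun t : ℝ => (1 / 48 : ℂ) * ∑ ε : Fin 3 → Bool, ((((if ε 0 then (1 : ℝ) else -1) * (if ε 1 then (1 : ℝ) else -1) * (if ε 2 then (1 : ℝ) else -1) : ℝ)) : ℂ) *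
        iteratedDeriv 3 (fun s : ℝ => (fun θ : Fin 3 → ℝ =>
          (((ζ * Circle.exp (θ 0) : Circle) : ℂ)) * ((((ζ * Circle.exp (θ 2) : Circle) : ℂ)))⁻¹ *
            ((1 - (((ζ * Circle.exp (θ 1) : Circle) : ℂ)) * ((((ζ * Circle.exp (θ 0) : Circle) : ℂ)))⁻¹) *
              (1 - (((ζ * Circle.exp (θ 2) : Circle) : ℂ)) * ((((ζ * Circle.exp (θ 1) : Circle) : ℂ)))⁻¹) *
              (1 - (((ζ * Circle.exp (θ 2) : Circle) : ℂ)) * ((((ζ * Circle.exp (θ 0) : Circle) : ℂ)))⁻¹)) *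
            Φ (fun j => ζ * Circle.exp (θ j)))
          (t • (![1, 1, -2] : Fin 3 → ℝ) + s • (![(if ε 0 then (1 : ℝ) else -1) + (if ε 1 then (1 : ℝ) else -1), -(if ε 0 then (1 : ℝ) else -1) + (if ε 2 then (1 : ℝ) else -1),
            -(if ε 1 then (1 : ℝ) else -1) - (if ε 2 then (1 : ℝ) else -1)] : Fin 3 → ℝ))) 0) (𝓝[>] 0) (𝓝 V) := by
  set W : Set (Fin 3 → ℝ) := {θ : Fin 3 → ℝ | ζ * Circle.exp (θ 0) ≠ ζ * Circle.exp (θ 2) ∧ ζ * Circle.exp (θ 1) ≠ ζ * Circle.exp (θ 2)} with hWdef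
  have hW : IsOpen W := isOpen_setOf_off_noncompact_walls ζ
  have hΦW : ContDiffOn ℝ 3 (fun θ : Fin 3 → ℝ => Φ (fun j => ζ * Circle.exp (θ j))) W := by
    rw [hΦ]
    exact (contDiffOn_orbital_angleChart_off_noncompact_walls L α w hα hreal hcpt ν Θ hΘ hΘc ζ).of_le
      (by exact_mod_cast ENat.natCast_le_of_coe_top_le_withTop le_rfl 3)
  have hF : ContDiffOn ℝ 3 (fun θ : Fin 3 → ℝ =>
      (((ζ * Circle.exp (θ 0) : Circle) : ℂ)) * ((((ζ * Circle.exp (θ 2) : Circle) : ℂ)))⁻¹ *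
        ((1 - (((ζ * Circle.exp (θ 1) : Circle) : ℂ)) * ((((ζ * Circle.exp (θ 0) : Circle) : ℂ)))⁻¹) *
          (1 - (((ζ * Circle.exp (θ 2) : Circle) : ℂ)) * ((((ζ * Circle.exp (θ 1) : Circle) : ℂ)))⁻¹) *
          (1 - (((ζ * Circle.exp (θ 2) : Circle) : ℂ)) * ((((ζ * Circle.exp (θ 0) : Circle) : ℂ)))⁻¹)) *
        Φ (fun j => ζ * Circle.exp (θ j))) W :=
    ((contDiff_rhoWeylDelta_angleChart ζ).of_le (by exact_mod_cast ENat.natCast_le_of_coe_top_le_withTop le_rfl 3)).contDiffOn.mul hΦW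
  have hwall : ∀ t ∈ Ioo 0 (2 : ℝ), t • (![1, 1, -2] : Fin 3 → ℝ) ∈ W := fun t ht =>
    wallPoint_off_noncompact_walls ζ (ne_of_gt ht.1) (by rw [abs_of_pos ht.1]; exact ht.2.le)
  exact tendsto_lambda8Line_wall_of_tendsto_nhdsWithin_chamber hW hF two_pos hwall σ hσ hV

end Orbital

end Literature.NumberTheory.Rogawski1990

end
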